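import Summits.HodgeConjecture.HodgeConjecture.Theorems.F0P2oN3TorusWeightOfD3d   -- (b)-assembler `thetaType_nonsplit_jacquetModule_b_of_torusWeight` (this seat)
import HarnessLib

/-!
# Crux `H413`, programme P2, N3 road — THE N3 PACKAGER: the print letter ★ `GelbartRogawski1991.thetaType_nonsplit_jacquetModule` FROM its clause (a)
# («`r_N(X_v) ≃ ℱ_v[ψθ]`») and the `m(γ)`-weight on `r_N(X_v)` (brick (D3d)), through the (b)-assembler `F0P2oN3TorusWeightOfD3d`

Cell hodgecm-mathlib (D-0151), FLOOR 0, crux item H413 = stmt-HodgeConjecture-24833, programme P2; N3 road of the K1 lead B-p18 (g28)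
(`F0/P2/B-p18/g28/N3-ROAD.v2.B-p18g28.md` 431ec2a705fc6088 §3 «N3 `_holds`»; lead «=» 2026-08-31T20:54:00Z).  Seat F0P2-p06 (g3).  THEOREMS ONLY; no
`Cruxes/…/Lines` import; kernel lane `--supports stmt-HodgeConjecture-24833 --as helper`.  HC_CM is proved only modulo the 2 remaining named inputs (hLiu418, h413)
— behind them the booked printed statements + the MOD package — until rung 0 closes; this file proves no letter: it is the one-token FOLD TARGET of N3 once its
two bricks land (+ §0, the matrix read-off `t = d(t₀₀, 1, σ(t₀₀)⁻¹)` docking a constructed `m(γ)` into the `torusEntry` sockets) — `hA` = clause (a) ∀-closed over the letter's binders (the (a)-block: (S4) ★ p834408 ∘ CM closer ★ p832817 ∘ (S5) dictionary), `hD` = the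
`m(γ)`-weight ∀-closed (the (b)-block: (D3d), A-p16 (g24), through ★ `thetaType_nonsplit_jacquetModule_b_of_kerWeight` ∕ `_of_torusWeight`).
[GelbartRogawski1991 §3.2 (3.2.1)–(3.2.3) p. 457; Kudla1986 Thm. 2.8; Rogawski1990 §12.2 (2) p. 174.]

## References
* [GelbartRogawski1991] S. Gelbart, J. Rogawski, Invent. Math. 105 (1991): §3.2 (3.2.1)–(3.2.3) p. 457; §5.2 p. 467.
* [Kudla1986] S. Kudla, Invent. Math. 83 (1986): Thm. 2.8.  [Rogawski1990] J. Rogawski, Ann. of Math. Stud. 123 (1990): §12.2 (2) p. 174.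
-/

set_option autoImplicit false
-- the mandated namespace has the single-problem summit's repeated segment (`HodgeConjecture.HodgeConjecture`)
set_option linter.dupNamespace false

noncomputable section

open NumberField IsDedekindDomain MeasureTheory
open scoped Matrix

open Literature.NumberTheory Literature.NumberTheory.Automorphic Literature.NumberTheory.Automorphic.UnitaryGroup
open Literature.NumberTheory.Automorphic.IdeleClassGroup
open Literature.NumberTheory.Automorphic.Liu2021 Literature.NumberTheory.Automorphic.Liu2021.Def411WeilCarriers
open Literature.NumberTheory.Automorphic.Liu2021.Def411WeilCarriersDoubling
open Literature.NumberTheory.GelbartRogawski1991.UnitaryDualPair Literature.NumberTheory.GelbartRogawski1991.UnitaryDualPair.WeilCoinv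
open Literature.RepresentationTheory.Liu2021
open Literature.NumberTheory.GaloisRepresentations
open Literature.NumberTheory.Rogawski1990
open Literature.NumberTheory.GelbartRogawski1991
open Literature.RepresentationTheory

open Summit.HodgeConjecture.HodgeConjecture.Cruxes.H413.F0P2oN3TorusWeightOfD3d

namespace Summit.HodgeConjecture.HodgeConjecture.Cruxes.H413.F0P2oN3OfTorusWeight

/-! ## §0 The matrix read-off of the `m(γ)`-socket: a torus element with middle entry `1` IS `d(γ, 1, γ̄⁻¹)`, `γ = t₀₀` -/

/-- **`t = d(t₀₀, 1, σ(t₀₀)⁻¹)` for `t ∈ T(L⁺_v)` with `t₁₁ = 1`** — the read-off that docks a CONSTRUCTED `m(γ) = glDiagonal ![γ, 1, (σγ)⁻¹]` (the (D3d) bricks) into the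
`torusEntry`-currency sockets `hD`∕`hK` of ★ `F0P2oN3TorusWeightOfD3d` (unitarity on the antidiagonal form: `σ(d₀)·d₂ = 1`, ★ `glDiagonal_mem_unitaryGroupOfForm_antidiagonal_iff`).
[cite: Rogawski1990, §1.10 p. 9] -/
theorem glDiagonal_torusEntry_eq_of_torusEntry_one_eq (L : Type) [Field L] [NumberField L] [IsCMField L]
    (v : HeightOneSpectrum (𝓞 ↥(maximalRealSubfield L))) (t : ↥(cmBorelTriple L 3 v).M)
    (ht : torusEntry (conjLocal L (IsCMField.complexConj L) v) (cmLocalForm L 3 v) 1 t = 1) :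
    glDiagonal 3 (LocalRing L v) ![torusEntry (conjLocal L (IsCMField.complexConj L) v) (cmLocalForm L 3 v) 0 t, 1,
        (Units.map (conjLocal L (IsCMField.complexConj L) v : LocalRing L v →* LocalRing L v)
          (torusEntry (conjLocal L (IsCMField.complexConj L) v) (cmLocalForm L 3 v) 0 t))⁻¹] =
      ((t : ↥(unitaryGroupOfForm (conjLocal L (IsCMField.complexConj L) v) (cmLocalForm L 3 v))) : GL (Fin 3) (LocalRing L v)) := by
  obtain ⟨d, hd⟩ := (mem_torusU_iff _).1 t.2
  have hdU : glDiagonal 3 (LocalRing L v) d ∈ unitaryGroupOfForm (conjLocal L (IsCMField.complexConj L) v)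
      ((StdForm.antidiagonal 3).over (LocalRing L v)) := by
    rw [hd, ← cmLocalForm_eq_over L 3 v]; exact (t : ↥(unitaryGroupOfForm (conjLocal L (IsCMField.complexConj L) v) (cmLocalForm L 3 v))).2
  have h02 : conjLocal L (IsCMField.complexConj L) v (d 0 : LocalRing L v) * (d 2 : LocalRing L v) = 1 := by
    have h := (glDiagonal_mem_unitaryGroupOfForm_antidiagonal_iff (conjLocal L (IsCMField.complexConj L) v) 3 d).1 hdU 2
    have hrev2 : Fin.rev (2 : Fin 3) = 0 := by decide
    rwa [hrev2] at h
  have hd2 : d 2 = (Units.map (conjLocal L (IsCMField.complexConj L) v : LocalRing L v →* LocalRing L v) (d 0))⁻¹ :=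
    (inv_eq_of_mul_eq_one_right (Units.ext (by rw [Units.val_mul, Units.coe_map, MonoidHom.coe_coe, Units.val_one]; exact h02))).symm
  have hd1 : d 1 = 1 := by rw [← torusEntry_eq_of_glDiagonal_eq (conjLocal L (IsCMField.complexConj L) v) (cmLocalForm L 3 v) 1 t d hd]; exact ht
  rw [← hd, torusEntry_eq_of_glDiagonal_eq (conjLocal L (IsCMField.complexConj L) v) (cmLocalForm L 3 v) 0 t d hd]
  congr 1
  funext i
  fin_cases i
  · rfl
  · exact hd1.symm
  · exact hd2.symm

set_option synthInstance.maxHeartbeats 400000 in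
set_option maxHeartbeats 16000000 in
/-- **★ `GelbartRogawski1991.thetaType_nonsplit_jacquetModule` FROM ITS CLAUSE (a) AND THE `m(γ)`-WEIGHT** (the N3 `_holds` fold, one token once both land):
`hA` = clause (a) («`r_N(X_v) ≃ ℱ_v[ψθ]`», ∀-closed over the letter's binders — the (a)-block: (S4) ★ p834408 ∘ CM closer ★ p832817 ∘ (S5)), `hD` = the
`m(γ)`-weight on `r_N(X_v)` (∀-closed; the (b)-block: (D3d) through §1's `jacquetModule_twistedCoinv_comp_eq_smul`).  Conclusion: the letter VERBATIM.
[cite: GelbartRogawski1991, §3.2 (3.2.1)–(3.2.3) p. 457] [cite: Kudla1986, Thm. 2.8] [cite: Rogawski1990, §12.2 (2) p. 174] -/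
theorem thetaType_nonsplit_jacquetModule_of_a_of_torusWeight
    (hA : ∀ (L : Type) [Field L] [NumberField L] [IsCMField L]
      {n' : ℕ} (e₁ : Fin 3 × Fin 1 ≃ Fin n') (dV : Fin 3 → L) (hdV : ∀ i, IsCMField.complexConj L (dV i) = dV i) (hdV0 : ∀ i, dV i ≠ 0)
      {n₀ : ℕ} (e₀ : Fin 1 × Fin 1 ≃ Fin n₀)
      (μ : Literature.NumberTheory.Automorphic.IdeleClassGroup L →ₜ* Circle) (hμ : IsConjugateSymplectic L μ)
      (χf : UnitaryGroup.finAdelicOne (↥(maximalRealSubfield L)) L (IsCMField.complexConj L) →* ℂˣ),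
      Continuous χf → (∀ z, ‖((χf z : ℂˣ) : ℂ)‖ = 1) →
      ∀ (v : HeightOneSpectrum (𝓞 ↥(maximalRealSubfield L))),
        (∀ w : PlacesOver L v, IsCMField.complexConj L • w.1 = w.1) →
        ∀ (ε : (↥(maximalRealSubfield L))ˣ) (ψθ : ↥(normOneUnits (conjLocal L (IsCMField.complexConj L) v)) →* ℂˣ),
          IsThetaCenterChar L μ χf ε v ψθ →
          ∀ (T : GL (Fin 3) (UnitaryGroup.LocalRing L v)) (a : UnitaryGroup.LocalRing L v) (ha : IsUnit a)
            (h : formCongr (conjLocal L (IsCMField.complexConj L) v) T ((Matrix.diagonal dV).map (algebraMap L (UnitaryGroup.LocalRing L v))) =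
              a • (Matrix.of fun i j : Fin 3 => if i.val + j.val + 1 = 3 then (1 : L) else 0).map (algebraMap L (UnitaryGroup.LocalRing L v))),
            Nonempty (((cmBorelTriple L 3 v).restrict (xThetaGqsCM L e₁ dV hdV hdV0 μ hμ χf ε v T ha h)).Coinvariants ≃ₗ[ℂ]
              ↥(weightSpace (lineWeilCM L e₀ (kernelLineCM dV) (complexConj_kernelLineCM dV hdV) (kernelLineCM_ne_zero dV hdV0) μ hμ ε v) id
                (fun u => ((ψθ (localDet (IsCMField.complexConj L) v
                  (isUnit_iff_ne_zero.mpr (by rw [Matrix.det_fin_one]; exact JW_apply_ne_zero (↥(maximalRealSubfield L)) L ε))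
                  (localPiEquiv L (IsCMField.complexConj L) 1 (JW (↥(maximalRealSubfield L)) L ε) v u)) : ℂˣ) : ℂ)))))
    (hD : ∀ (L : Type) [Field L] [NumberField L] [IsCMField L]
      {n' : ℕ} (e₁ : Fin 3 × Fin 1 ≃ Fin n') (dV : Fin 3 → L) (hdV : ∀ i, IsCMField.complexConj L (dV i) = dV i) (hdV0 : ∀ i, dV i ≠ 0)
      (μ : Literature.NumberTheory.Automorphic.IdeleClassGroup L →ₜ* Circle) (hμ : IsConjugateSymplectic L μ)
      (χf : UnitaryGroup.finAdelicOne (↥(maximalRealSubfield L)) L (IsCMField.complexConj L) →* ℂˣ),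
      Continuous χf → (∀ z, ‖((χf z : ℂˣ) : ℂ)‖ = 1) →
      ∀ (v : HeightOneSpectrum (𝓞 ↥(maximalRealSubfield L))),
        (∀ w : PlacesOver L v, IsCMField.complexConj L • w.1 = w.1) →
        ∀ (ε : (↥(maximalRealSubfield L))ˣ)
          (T : GL (Fin 3) (UnitaryGroup.LocalRing L v)) (a : UnitaryGroup.LocalRing L v) (ha : IsUnit a)
          (h : formCongr (conjLocal L (IsCMField.complexConj L) v) T ((Matrix.diagonal dV).map (algebraMap L (UnitaryGroup.LocalRing L v))) =
            a • (Matrix.of fun i j : Fin 3 => if i.val + j.val + 1 = 3 then (1 : L) else 0).map (algebraMap L (UnitaryGroup.LocalRing L v)))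
          (t : ↥(cmBorelTriple L 3 v).M),
          torusEntry (conjLocal L (IsCMField.complexConj L) v) (cmLocalForm L 3 v) 1 t = 1 →
          ∀ x : ((cmBorelTriple L 3 v).restrict (xThetaGqsCM L e₁ dV hdV hdV0 μ hμ χf ε v T ha h)).Coinvariants,
            Representation.jacquetModule (xThetaGqsCM L e₁ dV hdV hdV0 μ hμ χf ε v T ha h) (cmBorelTriple L 3 v) t x =
              (((toHeckeCharacter L μ).semilocalComponent L v (torusEntry (conjLocal L (IsCMField.complexConj L) v) (cmLocalForm L 3 v) 0 t) *
                  halfModulusChar (UnitaryGroup.LocalRing L v) (torusEntry (conjLocal L (IsCMField.complexConj L) v) (cmLocalForm L 3 v) 0 t) : ℂˣ) : ℂ) • x) :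
    Literature.NumberTheory.GelbartRogawski1991.thetaType_nonsplit_jacquetModule := by
  intro L _ _ _ n' e₁ dV hdV hdV0 n₀ e₀ μ hμ χf hc hu v hv ε ψθ hθ T a ha h
  exact ⟨hA L e₁ dV hdV hdV0 e₀ μ hμ χf hc hu v hv ε ψθ hθ T a ha h,
    thetaType_nonsplit_jacquetModule_b_of_torusWeight L e₁ dV hdV hdV0 μ hμ χf v ε ψθ hθ T ha h
      (hD L e₁ dV hdV hdV0 μ hμ χf hc hu v hv ε T a ha h)⟩

end Summit.HodgeConjecture.HodgeConjecture.Cruxes.H413.F0P2oN3OfTorusWeight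

end
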